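import Literature.NumberTheory.EllipticCurves.PlusMinusPAdicLFunctionProofs
import Literature.NumberTheory.EllipticCurves.PAdicLFunctionInterpolationProofs
import Literature.NumberTheory.EllipticCurves.PAdicLFunctionIntegralityAtTwoProofs
import Literature.NumberTheory.EllipticCurves.Kato2004.TeichmullerBranchIndex
import Summits.BirchSwinnertonDyer.BirchSwinnertonDyer.Theorems.SignedLowerHalvesKobayashiMainConjectureSmallImageOrbitSumMu
import HarnessLib

/-!
# Route `SignedLowerHalves`, crux `KobayashiMainConjectureSmallImage` (item stmt-BirchSwinnertonDyer-19002),
# line `birth_acns`, stub `stub_muOneSign_ns_three`: the one-sign μ-rider AT `p = 3` READ ON INDIVIDUAL PLUS SYMBOLS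
# — «both `μ(L₃^±) > 0` ⇒ every `[a/3^{n+1}]⁺_f` (`3 ∤ a`) vanishes mod 3», i.e. the rider from ONE unit plus symbol
# (cell `bsd-ssimc`, seat `bsd-line-slh-p3` gen 8; THEOREMS ONLY; helper, companion of `…SmallImageOrbitSumMu.lean`)

WHAT. Companion of `Theorems/…SmallImageOrbitSumMu.lean` (p636207: `μ(L^ε) > 0` ⇒ every group-ring coefficient of `θ_n`
of parity `ε` is divisible by `p`). Here the group-ring coefficients are IDENTIFIED with the ω⁰ orbit sums
(`coeff_comp_mazurTateElement`: `coeff_s(θ_n ∘ (T−1)) = Σ_η [η γ^s/p^{n+e₀}]⁺_f`, general `p`), and at `p = 3` — where the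
Teichmüller set is `{±1}` (`rootsOfUnity_three_eq`) and `[·]⁺` is even and `ℤ`-periodic — with TWICE ONE SYMBOL:
`coeff_s(θ_n ∘ (T−1)) = 2·[4^s/3^{n+1}]⁺_f` (`coeff_comp_mazurTateElement_three`). Since every unit of `ℤ/3^{n+1}` is `±4^s`
(`exists_eq_pow_four_or_neg`, from the tree's `finsum_sum_classes_eq_sum_units`), a signed function WITHOUT unit content forces
EVERY plus symbol `[u/3^{n+1}]⁺_f` (`u` a unit, `n` of its parity) to have 3-adic norm `< 1`
(`norm_ratPlusSymbol_three_lt_one_of_not_hasUnitContent`); contrapositive = the certificate / stub form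
`exists_sign_hasUnitContent_three_of_norm_ratPlusSymbol_eq_one`: ONE unit plus symbol `[u/3^{n+1}]⁺_f` gives
`∃ ε L, IsSignedPAdicLFunction f 3 ε L ∧ HasUnitContent L` (existence = tree THEOREM `pollack_exists_plusMinusPAdicLFunction_holds`).

WHY. This is exactly the interface of the ideator bsd-idea-13 g8's THEOREM A (`Cruxes/…/EG-REDUCTION-g8.md` §4.4–4.5): LEMMA′
(Venkataramana 1994 / Vaserstein 1972 finite index + Serre 1970 CSP + the kernel-checked coset lemma) and the Hecke identity at
`ℓ = 3` show that NOT every `[a/3^{n+1}]⁺_f` vanishes mod 3 when `a₃(f) = 0`; with this file that non-vanishing IS the rider at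
`p = 3`. Line `birth_acns` v6 states `stub_muOneSign_ns_three` in this symbol form.

HONEST SCOPE: conditional on nothing; proves no stub by itself (the non-vanishing of one symbol is the open input, on paper by
EG-REDUCTION-g8); crux 4 OPEN; BSD is not proved by any of this.

References: [Pollack2003] Def. 6.15, Rem. 6.16, Prop. 6.18; [MazurTateTeitelbaum1986Invent] §I.4 (4.2), §I.8, §I.13;
[PollackWeston2011] Thm. 4.1 (1), Rem. 4.2; tree `PlusMinusPAdicLFunctionProofs`, `PAdicLFunctionInterpolationProofs`.
-/

set_option linter.dupNamespace false
set_option autoImplicit false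

noncomputable section

open scoped Classical

open Polynomial Literature.NumberTheory.EllipticCurves Literature.NumberTheory.EllipticCurves.ModularForms
  Literature.NumberTheory.EllipticCurves.Kobayashi2003 Literature.NumberTheory.EllipticCurves.GreenbergVatsal2000
  CongruenceSubgroup Summit.BirchSwinnertonDyer.BirchSwinnertonDyer.Theorems.SmallImageOrbitSumMu

namespace Summit.BirchSwinnertonDyer.BirchSwinnertonDyer.Theorems.SmallImageOrbitSumMuThree

variable {N : ℕ} (f : CuspForm (Gamma0 N) 2)

/-- **The group-ring coefficients of `θ_n` are the ω⁰ orbit sums**: for `s < p^n`, the coefficient of `T^s` in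
`θ_n ∘ (T − 1)` — i.e. of `(1+T)^s` in `θ_n` — is `Σ_η [η γ^s / p^{n+e₀}]⁺_f`, `η` over the Teichmüller representatives
(Pollack 2003 Def. 6.15 read in `ℚ[Gal(ℚ_n/ℚ)]`, Remark 6.16). [cite: Pollack2003, Def. 6.15 and Remark 6.16] -/
theorem coeff_comp_mazurTateElement (p : ℕ) [Fact p.Prime] (n s : ℕ) (hs : s < p ^ n) :
    ((mazurTateElement f p n).comp (X - 1)).coeff s =
      ∑ᶠ η : rootsOfUnity (torsionOrder p) ℤ_[p],
        ratPlusSymbol f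
          (((PadicInt.toZModPow (n + cyclotomicExponent p) ((η : ℤ_[p]ˣ) : ℤ_[p]) *
                (cyclotomicGenerator p : ZMod (p ^ (n + cyclotomicExponent p))) ^ s).val : ℚ) /
            (p : ℚ) ^ (n + cyclotomicExponent p)) := by
  classical
  haveI := neZero_torsionOrder p
  haveI := Fintype.ofFinite (rootsOfUnity (torsionOrder p) ℤ_[p])
  haveI : NeZero (p ^ n) := ⟨pow_ne_zero _ (Fact.out : p.Prime).ne_zero⟩
  have hc : ∀ P : ℚ[X], P.comp (X - 1) = Polynomial.compRingHom (X - 1) P := fun P ↦ rfl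
  rw [mazurTateElement, finsum_eq_sum_of_fintype, finsum_eq_sum_of_fintype, hc, map_sum,
    Polynomial.finsetSum_coeff]
  refine Finset.sum_congr rfl fun η _ ↦ ?_
  rw [map_sum, Polynomial.finsetSum_coeff]
  have hcomp : ∀ (a : ℚ) (k : ℕ),
      (Polynomial.compRingHom (X - 1 : ℚ[X]) (C a * (X + 1) ^ k)).coeff s = if s = k then a else 0 := by
    intro a k
    rw [← hc, Polynomial.mul_comp, Polynomial.C_comp, Polynomial.pow_comp, Polynomial.add_comp, Polynomial.X_comp,
      Polynomial.one_comp, sub_add_cancel, Polynomial.coeff_C_mul_X_pow]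
  simp_rw [hcomp]
  rw [Finset.sum_eq_single (s : ZMod (p ^ n))]
  · rw [if_pos (ZMod.val_natCast_of_lt hs).symm, ZMod.val_natCast_of_lt hs]
  · intro s' _ hs'
    rw [if_neg]
    intro h
    apply hs'
    rw [h, ZMod.natCast_zmod_val]
  · intro h
    exact absurd (Finset.mem_univ _) h

/-- Helper: `−1 ∈ ℤ_3` as a Teichmüller representative (`torsionOrder 3 = 2`). [folklore] -/
theorem neg_one_mem_rootsOfUnity_three : (-1 : ℤ_[3]ˣ) ∈ rootsOfUnity (torsionOrder 3) ℤ_[3] := by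
  rw [mem_rootsOfUnity, Kato2004.torsionOrder_of_ne_two 3 (by decide)]
  norm_num

/-- The Teichmüller representatives at `p = 3` are `±1`. [folklore] -/
theorem rootsOfUnity_three_eq (η : rootsOfUnity (torsionOrder 3) ℤ_[3]) :
    η = 1 ∨ η = ⟨-1, neg_one_mem_rootsOfUnity_three⟩ := by
  have h3 : torsionOrder 3 = 2 := by rw [Kato2004.torsionOrder_of_ne_two 3 (by decide)]
  have h : (η : ℤ_[3]ˣ) ^ (torsionOrder 3) = 1 := (mem_rootsOfUnity _ _).mp η.2
  have h' : (η : ℤ_[3]ˣ) ^ 2 = 1 := by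
    simp only [h3] at h
    exact h
  have h2 : ((η : ℤ_[3]ˣ) : ℤ_[3]) * ((η : ℤ_[3]ˣ) : ℤ_[3]) = 1 := by
    rw [← Units.val_mul, ← sq, h', Units.val_one]
  rcases mul_self_eq_one_iff.mp h2 with h1 | h1
  · left
    exact Subtype.ext (Units.ext h1)
  · right
    exact Subtype.ext (Units.ext h1)

/-- **At `p = 3` the orbit sum is `2[a/3^{n+1}]⁺`**: for `s < 3^n` and `a = 4^s mod 3^{n+1}`,
`coeff_s(θ_n ∘ (T−1)) = [a/3^{n+1}]⁺ + [−a/3^{n+1}]⁺ = 2 [a/3^{n+1}]⁺` (`[·]⁺` is even and `ℤ`-periodic).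
[cite: Pollack2003, Def. 6.15] [cite: MazurTateTeitelbaum1986Invent, §I.4 (4.2) and §I.8] -/
theorem coeff_comp_mazurTateElement_three [NeZero N] (n s : ℕ) (hs : s < 3 ^ n) :
    ((mazurTateElement f 3 n).comp (X - 1)).coeff s =
      2 * ratPlusSymbol f ((((4 : ZMod (3 ^ (n + 1))) ^ s).val : ℚ) / (3 : ℚ) ^ (n + 1)) := by
  classical
  haveI := neZero_torsionOrder 3
  haveI := Fintype.ofFinite (rootsOfUnity (torsionOrder 3) ℤ_[3])
  rw [coeff_comp_mazurTateElement f 3 n s hs, finsum_eq_sum_of_fintype]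
  -- rewrite each summand into the `n + 1`, `γ = 4` form (`cyclotomicExponent 3 = 1` definitionally)
  have hγ4 : ((cyclotomicGenerator 3 : ℕ) : ZMod (3 ^ (n + 1))) = 4 := by
    have : cyclotomicGenerator 3 = 4 := rfl
    rw [this]
    norm_cast
  have key : ∀ η : rootsOfUnity (torsionOrder 3) ℤ_[3],
      ratPlusSymbol f ((((PadicInt.toZModPow (n + cyclotomicExponent 3) ((η : ℤ_[3]ˣ) : ℤ_[3])) *
          (cyclotomicGenerator 3 : ZMod (3 ^ (n + cyclotomicExponent 3))) ^ s).val : ℚ) /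
          ((3 : ℕ) : ℚ) ^ (n + cyclotomicExponent 3)) =
      ratPlusSymbol f ((((PadicInt.toZModPow (n + 1) ((η : ℤ_[3]ˣ) : ℤ_[3])) *
          (4 : ZMod (3 ^ (n + 1))) ^ s).val : ℚ) / (3 : ℚ) ^ (n + 1)) := by
    intro η
    change ratPlusSymbol f ((((PadicInt.toZModPow (n + 1) ((η : ℤ_[3]ˣ) : ℤ_[3])) *
          ((cyclotomicGenerator 3 : ℕ) : ZMod (3 ^ (n + 1))) ^ s).val : ℚ) / ((3 : ℕ) : ℚ) ^ (n + 1)) = _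
    rw [hγ4, Nat.cast_ofNat]
  simp only [key]
  -- the index set is `{1, −1}`
  set ηm : rootsOfUnity (torsionOrder 3) ℤ_[3] := ⟨-1, neg_one_mem_rootsOfUnity_three⟩ with hηm
  have hne : (1 : rootsOfUnity (torsionOrder 3) ℤ_[3]) ≠ ηm := by
    intro h
    have h1 := congr_arg (fun η : rootsOfUnity (torsionOrder 3) ℤ_[3] ↦ ((η : ℤ_[3]ˣ) : ℤ_[3])) h
    simp only [hηm, OneMemClass.coe_one, Units.val_one, Units.val_neg] at h1
    norm_num at h1
  have huniv : (Finset.univ : Finset (rootsOfUnity (torsionOrder 3) ℤ_[3])) = {1, ηm} := by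
    ext η
    simp only [Finset.mem_univ, Finset.mem_insert, Finset.mem_singleton, true_iff]
    exact rootsOfUnity_three_eq η
  rw [huniv, Finset.sum_pair hne]
  -- evaluate the two terms
  haveI hN : NeZero (3 ^ (n + 1)) := ⟨pow_ne_zero _ (by decide)⟩
  set x : ZMod (3 ^ (n + 1)) := (4 : ZMod (3 ^ (n + 1))) ^ s with hx
  have h1 : PadicInt.toZModPow (n + 1) (((1 : rootsOfUnity (torsionOrder 3) ℤ_[3]) : ℤ_[3]ˣ) : ℤ_[3]) = 1 := by
    rw [OneMemClass.coe_one, Units.val_one, map_one]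
  have h2 : PadicInt.toZModPow (n + 1) (((ηm : rootsOfUnity (torsionOrder 3) ℤ_[3]) : ℤ_[3]ˣ) : ℤ_[3]) = -1 := by
    rw [hηm]
    simp only [Units.val_neg, Units.val_one, map_neg, map_one]
  rw [h1, h2, one_mul, neg_one_mul]
  -- `[(−x).val / 3^{n+1}]⁺ = [x.val / 3^{n+1}]⁺`
  have hx0 : x ≠ 0 := by
    rw [hx]
    have h4 : IsUnit (4 : ZMod (3 ^ (n + 1))) := by
      rw [show (4 : ZMod (3 ^ (n + 1))) = ((4 : ℕ) : ZMod (3 ^ (n + 1))) by norm_cast]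
      exact (ZMod.isUnit_iff_coprime 4 (3 ^ (n + 1))).mpr (Nat.Coprime.pow_right _ (by decide))
    haveI : Nontrivial (ZMod (3 ^ (n + 1))) := ZMod.nontrivial_iff.mpr (by
      have := Nat.one_lt_pow (n := n + 1) (by omega) (show 1 < 3 by decide); omega)
    exact (h4.pow s).ne_zero
  have hval : ((-x).val : ℚ) = (3 : ℚ) ^ (n + 1) - (x.val : ℚ) := by
    rw [ZMod.neg_val, if_neg hx0, Nat.cast_sub (le_of_lt (ZMod.val_lt x))]
    push_cast
    ring
  rw [hval, show ((3 : ℚ) ^ (n + 1) - (x.val : ℚ)) / (3 : ℚ) ^ (n + 1) =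
      -((x.val : ℚ) / (3 : ℚ) ^ (n + 1)) + ((1 : ℤ) : ℚ) by
    rw [Int.cast_one]; field_simp; ring]
  rw [ratPlusSymbol_add_intCast_eq, ratPlusSymbol_neg]
  ring

/-! ## The `p = 3` reading on INDIVIDUAL plus symbols -/

/-- `[(−x).val/3^{n+1}]⁺ = [x.val/3^{n+1}]⁺` for `x ≠ 0` in `ℤ/3^{n+1}` (evenness and `ℤ`-periodicity of `[·]⁺`).
[cite: MazurTateTeitelbaum1986Invent, §I.4 (4.2) and §I.8] -/
theorem ratPlusSymbol_neg_val_three [NeZero N] (n : ℕ) {x : ZMod (3 ^ (n + 1))} (hx0 : x ≠ 0) :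
    ratPlusSymbol f (((-x).val : ℚ) / (3 : ℚ) ^ (n + 1)) = ratPlusSymbol f ((x.val : ℚ) / (3 : ℚ) ^ (n + 1)) := by
  haveI hN : NeZero (3 ^ (n + 1)) := ⟨pow_ne_zero _ (by decide)⟩
  have hval : ((-x).val : ℚ) = (3 : ℚ) ^ (n + 1) - (x.val : ℚ) := by
    rw [ZMod.neg_val, if_neg hx0, Nat.cast_sub (le_of_lt (ZMod.val_lt x))]
    push_cast
    ring
  rw [hval, show ((3 : ℚ) ^ (n + 1) - (x.val : ℚ)) / (3 : ℚ) ^ (n + 1) =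
      -((x.val : ℚ) / (3 : ℚ) ^ (n + 1)) + ((1 : ℤ) : ℚ) by
    rw [Int.cast_one]; field_simp; ring]
  rw [ratPlusSymbol_add_intCast_eq, ratPlusSymbol_neg]

/-- **Every unit of `ℤ/3^{n+1}` is `±4^s` with `s < 3^n`** (the Teichmüller parametrisation `a = η γ^s` at `p = 3`; from the
tree's `finsum_sum_classes_eq_sum_units` applied to an indicator function). [cite: MazurTateTeitelbaum1986Invent, §I.13] -/
theorem exists_eq_pow_four_or_neg (n : ℕ) (u : (ZMod (3 ^ (n + 1)))ˣ) :
    ∃ s : ℕ, s < 3 ^ n ∧ ((u : ZMod (3 ^ (n + 1))) = (4 : ZMod (3 ^ (n + 1))) ^ s ∨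
      (u : ZMod (3 ^ (n + 1))) = -(4 : ZMod (3 ^ (n + 1))) ^ s) := by
  classical
  haveI := neZero_torsionOrder 3
  haveI := Fintype.ofFinite (rootsOfUnity (torsionOrder 3) ℤ_[3])
  -- the indicator of `u`, summed over the Teichmüller classes = summed over the units = 1
  have hsum := finsum_sum_classes_eq_sum_units (p := 3) n (fun v : ZMod (3 ^ (n + cyclotomicExponent 3)) ↦
    if v = (u : ZMod (3 ^ (n + 1))) then (1 : ℕ) else 0)
  have hR : (∑ v : (ZMod (3 ^ (n + cyclotomicExponent 3)))ˣ,
      (if ((v : ZMod (3 ^ (n + cyclotomicExponent 3))) = (u : ZMod (3 ^ (n + 1)))) then (1 : ℕ) else 0)) = 1 := by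
    change (∑ v : (ZMod (3 ^ (n + 1)))ˣ, (if ((v : ZMod (3 ^ (n + 1))) = (u : ZMod (3 ^ (n + 1)))) then (1 : ℕ) else 0)) = 1
    rw [Finset.sum_eq_single u]
    · rw [if_pos rfl]
    · intro v _ hv
      rw [if_neg (fun h ↦ hv (Units.ext h))]
    · intro h
      exact absurd (Finset.mem_univ _) h
  rw [hR, finsum_eq_sum_of_fintype] at hsum
  -- so some class hits `u`
  obtain ⟨η, -, hη⟩ := Finset.exists_ne_zero_of_sum_ne_zero (by rw [hsum]; exact one_ne_zero)
  obtain ⟨t, -, ht⟩ := Finset.exists_ne_zero_of_sum_ne_zero hη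
  have hγ4 : ((cyclotomicGenerator 3 : ℕ) : ZMod (3 ^ (n + 1))) = 4 := by
    have : cyclotomicGenerator 3 = 4 := rfl
    rw [this]
    norm_cast
  have heq : PadicInt.toZModPow (n + 1) ((η : ℤ_[3]ˣ) : ℤ_[3]) * (4 : ZMod (3 ^ (n + 1))) ^ t.val =
      (u : ZMod (3 ^ (n + 1))) := by
    rw [← hγ4]
    by_contra hne
    exact ht (if_neg hne)
  refine ⟨t.val, t.val_lt, ?_⟩
  rcases rootsOfUnity_three_eq η with rfl | rfl
  · left
    rw [← heq, OneMemClass.coe_one, Units.val_one, map_one, one_mul]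
  · right
    rw [← heq]
    simp only [Units.val_neg, Units.val_one, map_neg, map_one, neg_one_mul]

/-- **`p = 3`: `μ(L₃^ε) > 0` forces EVERY plus symbol `[a/3^{n+1}]⁺_f` (`3 ∤ a`, `n` of parity `ε`) to vanish mod 3.**
`f` a rational newform of level `N`, `3 ∤ N`, `a₃(f) = 0`; `L` a signed function of sign `ε` (tree's rational congruence) WITHOUT
unit content; `n` even for `ε = 1`, odd for `ε = −1`. Then `‖[u/3^{n+1}]⁺_f‖₃ < 1` for every unit `u` of `ℤ/3^{n+1}`.
[cite: Pollack2003, Prop. 6.18] [cite: PollackWeston2011, Thm. 4.1 (1)] -/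
theorem norm_ratPlusSymbol_three_lt_one_of_not_hasUnitContent [NeZero N] (hf0 : IsNewform0 f) (h3N : ¬ 3 ∣ N)
    (hap : cuspCoeff f 3 = ((0 : ℤ) : ℂ)) {n : ℕ} {ε : ℤˣ} (hε : (Even n ∧ ε = 1) ∨ (Odd n ∧ ε = -1))
    {L : IwasawaAlgebra 3} (hL : IsSignedPAdicLFunction f 3 ε L) (hμ : ¬ HasUnitContent L)
    (u : (ZMod (3 ^ (n + 1)))ˣ) :
    ‖((ratPlusSymbol f (((u : ZMod (3 ^ (n + 1))).val : ℚ) / (3 : ℚ) ^ (n + 1)) : ℚ) : ℚ_[3])‖ < 1 := by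
  haveI hN : NeZero (3 ^ (n + 1)) := ⟨pow_ne_zero _ (by decide)⟩
  haveI : Nontrivial (ZMod (3 ^ (n + 1))) := ZMod.nontrivial_iff.mpr (by
    have := Nat.one_lt_pow (n := n + 1) (by omega) (show 1 < 3 by decide); omega)
  obtain ⟨s, hs, hu⟩ := exists_eq_pow_four_or_neg n u
  -- the symbol at `u` equals the symbol at `4^s`
  have hsym : ratPlusSymbol f (((u : ZMod (3 ^ (n + 1))).val : ℚ) / (3 : ℚ) ^ (n + 1)) =
      ratPlusSymbol f ((((4 : ZMod (3 ^ (n + 1))) ^ s).val : ℚ) / (3 : ℚ) ^ (n + 1)) := by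
    rcases hu with hu | hu
    · rw [hu]
    · rw [hu]
      refine ratPlusSymbol_neg_val_three f n ?_
      intro h0
      apply u.ne_zero
      rw [hu, h0, neg_zero]
  -- the orbit sum `2[4^s/3^{n+1}]⁺` has norm `< 1`
  have hcoeff := norm_coeff_comp_mazurTateElement_lt_one_of_isSignedPAdicLFunction (p := 3) (by decide) hf0 h3N hap
    hε hL hμ s
  rw [coeff_comp_mazurTateElement_three f n s hs] at hcoeff
  push_cast at hcoeff
  rw [norm_mul] at hcoeff
  have h2 : ‖((2 : ℚ) : ℚ_[3])‖ = 1 := by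
    rw [show ((2 : ℚ) : ℚ_[3]) = ((2 : ℕ) : ℚ_[3]) by norm_cast, Padic.norm_natCast_eq_one_iff]
    decide
  rw [hsym]
  rwa [show ((2 : ℚ_[3])) = ((2 : ℚ) : ℚ_[3]) by norm_cast, h2, one_mul] at hcoeff

/-- **`p = 3` certificate / the form of `stub_muOneSign_ns_three`**: `W/ℚ` globally minimal with good reduction at `3` and
`a₃ = 0`, `f` its newform. ONE plus symbol `[u/3^{n+1}]⁺_f` (`u` a unit mod `3^{n+1}`, any `n ≥ 0`) that is a 3-adic UNIT
yields a signed Pollack function with unit content: `∃ ε L, IsSignedPAdicLFunction f 3 ε L ∧ HasUnitContent L` (`ε` = the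
parity sign of `n`; existence = tree THEOREM `pollack_exists_plusMinusPAdicLFunction_holds`). Equivalently: if BOTH `μ(L₃^±) > 0`
then EVERY `[a/3^{n+1}]⁺_f`, `3 ∤ a`, vanishes mod 3 — the hypothesis refuted by EG-REDUCTION-g8's LEMMA′ + Hecke at `ℓ = 3`.
[cite: Pollack2003, Thm. 5.6 and Prop. 6.18] [cite: PollackWeston2011, Thm. 4.1 (1) and Remark 4.2] -/
theorem exists_sign_hasUnitContent_three_of_norm_ratPlusSymbol_eq_one [NeZero N] {W : WeierstrassCurve ℚ}
    [W.IsElliptic] [W.IsGloballyMinimal] (hf : IsNewformOf W f) (hgood : W.HasGoodReductionAtPrime 3)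
    (hap : W.frobeniusTrace 3 = 0) {n : ℕ} (u : (ZMod (3 ^ (n + 1)))ˣ)
    (hunit : ‖((ratPlusSymbol f (((u : ZMod (3 ^ (n + 1))).val : ℚ) / (3 : ℚ) ^ (n + 1)) : ℚ) : ℚ_[3])‖ = 1) :
    ∃ (ε : ℤˣ) (L : IwasawaAlgebra 3), IsSignedPAdicLFunction f 3 ε L ∧ HasUnitContent L := by
  have h32 : (3 : ℕ) ≠ 2 := by decide
  have h3N : ¬ 3 ∣ N := not_dvd_level_of_isNewformOf hf hgood
  have hap' : cuspCoeff f 3 = ((0 : ℤ) : ℂ) := by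
    rw [cuspCoeff_eq_frobeniusTrace_of_isNewformOf_holds hf hgood, hap]
  have hε : ∃ ε : ℤˣ, (Even n ∧ ε = 1) ∨ (Odd n ∧ ε = -1) := by
    rcases Nat.even_or_odd n with hn | hn
    · exact ⟨1, Or.inl ⟨hn, rfl⟩⟩
    · exact ⟨-1, Or.inr ⟨hn, rfl⟩⟩
  obtain ⟨ε, hε⟩ := hε
  obtain ⟨L, -, hL⟩ := exists_isSignedPAdicLFunction (pollack_exists_plusMinusPAdicLFunction_holds) h32 hf hgood hap ε
  refine ⟨ε, L, hL, ?_⟩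
  by_contra hμ
  have h := norm_ratPlusSymbol_three_lt_one_of_not_hasUnitContent f hf.1 h3N hap' hε hL hμ u
  rw [hunit] at h
  exact lt_irrefl _ h

end Summit.BirchSwinnertonDyer.BirchSwinnertonDyer.Theorems.SmallImageOrbitSumMuThree

end
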